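import Summits.QuantumFields.BalabanUV.T4Continuum.Spine.NE9.DirectPairingApexBudget
import Summits.QuantumFields.BalabanUV.T4Continuum.Spine.NE9.DirectPairingCrossover

/-!
# T⁴ programme, spine estimate NE9 — THE KING ROUTE'S E-SIDE END, AND THE ONE FIELD IT CANNOT TAKE FROM THE CELL'S DESIGN SHAPES:
# an ADAPTED recent window (C40) has a bad-class budget that tends to zero but is NOT summable, so the `summable` fields of
# `RelWeightBound` ∕ `ShellWeightBound` (idle for King's matching) must be dropped — census items C42–C43 of cell `pub-balaban-gaps`,
# seat ne9 (gen 12)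

Cell `pub-balaban-gaps` (YM blitz G2, seat ne9, unit `pub-balaban-gaps-ne9-g12`; record `run/shared/lean/pub/pub-balaban-gaps/ne/NE9.md`
§5 rows C42–C43).  Summits-side bookkeeping over the tree's node-U5∕U6 vocabulary (`T4HybridMatching.HybridSandwich`, `hybridDelta`;
`T4GoodClassBudget.GoodClause`; `T4MatchingClosure.ReindexedBudget`, `goodClause_of_reindexed`) and this seat's gens 10–11
(`DirectPairingApex`, `DirectPairingApexBudget`, `DirectPairingCrossover`; `DirectPairingWindow` ∕ `DirectPairingUVTail` enter in the sequel).  NO definition;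
nothing of Bałaban's asserted.

WHY.  Gen 11 closed the E-side of NE9-as-consumed on the KING route (runs `K`, `K + n` compared directly, remainders `→ 0` n-uniformly,
[King1986] Thm 3.4) slot by slot: the recent RADIUS through node U4′'s crossover against the printed size branch (C39), the recent DEVIATION
through an ADAPTED window `m(K) → ∞` chosen after the profile `b` (C40 — the adaptivity is necessary, `DirectPairingWindowSharp`), the
unpaired scales by print (C41); and gen 10 consumed the cell's node-U5 closure down to the re-indexed term budget
(`DirectPairingApexBudget.cauchy_of_reindexedBudget`, C38d).  QUESTION (C42): do these compose?  The END of C38d takes NE7b's ∕ NE7c's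
OUTPUT SHAPES `T4WeightBudget.RelWeightBound` ∕ `T4IndicatorShell.ShellWeightBound`, and those structures carry the fields
`summable : Summable W` ∕ `Summable Wsh` — written for the CONSECUTIVE organisation (`T4HybridMatching.summable_hybridDelta`), and exactly
the constraint that forces the recent window to be logarithmic (`T4MatchingClosure.relWeightBound_of_slotDom_log`: `W K = V·r^{K − jlog(K)}`,
`(K+1)^{−C(−log r)}` summable).  C40's adapted window has bad-class budget `V·r₀^{m(K)} → 0`, in general NOT summable.  So, as typed, C38d's
END cannot take C40's window — C40 cited `DirectPairingApexDesign.kingMatching_of_design` for «`W_K → 0` only», which is true of KING'S MATCHING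
(`DirectPairingApex.kingMatching_of_hybridSandwich` ∕ `cauchy_of_hybridSandwichFamily`, C38b: `W K < 1`, `W → 0`) but not of that decl's binders.

ANSWER (kernel, this file).
* §1 THE `summable` FIELDS ARE IDLE FOR KING.  `hybridSandwich_of_goodClause`: per pair `(K, K + n)` the good clause
  (`T4GoodClassBudget.GoodClause`, width `vol·δ K`) + `Bad ⊆ T` + nonnegative weights + the two bad-class RELATIVE-WEIGHT inequalities with
  weight `W K` (the fields `bad_subset` ∕ `bad_left` ∕ `bad_right` of `RelWeightBound`, nothing else) give the tree's `HybridSandwich`;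
  `kingMatching_of_goodClause` ∕ `cauchy_of_goodClause` (`W K < 1`; `δ, W → 0`) and `cauchy_of_reindexedBudget₀` — the summability-free form
  of C38d: `ReindexedBudget` per pair (that structure has no summability field) with `r, u, s, s₂ → 0` and `W → 0` ⇒ Cauchy generating functions,
  uniform on the `l₀`-ball.  Shell-free (NE7c's shells would enter the same way through `T4IndicatorShell.refT` ∕ `refVal`; not needed on the E-side).
* §2 TWO-SIDED (C42 proper).  `summableBudget_window_not_tendsto`: for `0 < r₀ < 1`, `Λ ≥ r₀⁻¹` (`Λ = L⁴`), EVERY window `m K ≤ K` whose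
  bad-class budget `Σ_K r₀^{m K}` is SUMMABLE is defeated by the admissible profile `b_j = 1∕log(j+2)` (`logProfile_admissible`): summability against
  the harmonic series gives `r₀^{m K} < 1∕(K+1)` infinitely often, there `Λ^{m K} > K + 1` and the `j = K − m K` term is `≥ (K+1)∕log(K+2) ≥ 1`.
  (The companion «for the same data King's adapted window EXISTS and every window passing the profile has a NON-summable budget» is
  `DirectPairingEndWindow.kingWindow_budget_not_summable`, the sequel file importing `DirectPairingWindow`.)  So under the typed `summable`
  fields King's qualitative currency is DEAD at node U5b's deviation slot
  (the E-side would owe a RATE there — `b_j·(K+1)^{C log Λ} → 0` on the log window, a quantitative modulus in the young couplings, C25's currency);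
  with §1 it is alive.  The fields are the consecutive currency's, not an estimate: NOTHING new is owed by anyone — the END had to move one level up.
* §3 THE E-SIDE END ALONG A KING WINDOW (C43; gen 11's door (a)).  `king_end_of_window`: from ONE profile `b → 0`, the printed size data, a King
  window `m` (bad-class budget `V·r₀^{m K} → 0`, `< 1`; deviation window sum `→ 0` — both by `DirectPairingWindow.exists_kingWindow`), the non-E-side
  rate pieces `w, u, s', s₂ → 0`, and PRODUCERS delivering the dictionary, a bad class of relative weight `≤ V·r₀^{m K}` and a `ReindexedBudget` whose
  recent slots carry C39's crossover majorant (`r`) and C40's window sum (`s`) verbatim: Cauchy + uniform convergence, by `tendsto_kingCrossover` → §1.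
  (The sequel `DirectPairingEndWindow.king_end_of_profile` discharges the window and the UV tails of C41 BY NAME — `exists_kingWindow`,
  `tendsto_badBudget_of_window`, `uvTail_tendsto` ∕ `uvTailR_tendsto` — and `exists_kingWindow_finset` serves finitely many profiles at once, C44.)

VERDICT FOR THE ROWS.  C42: the King route and the cell's node-U5 design shapes are compatible up to ONE idle field — `Summable W` (and `Summable
Wsh`) — which King's organisation cannot supply with an adapted window and never uses; two-sided in the kernel.  C43: with that field dropped the
E-side of NE9-as-consumed is ONE kernel implication from «a scale profile `b_j → 0`» + a King window + print + the T4-DAG's producers to node U6.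
HONEST RESIDUE (unchanged): the producers (`hprod`) — NE7b's weights for the cut `K − m K` with `m` sub-logarithmic
(its p-series bookkeeping `summable_weightMajorant_log` is not available there; only `r₀^{m K} → 0` is asked), NE-R1's two-run half proper, the other
kinds, run `K + n`'s shells — owner T4-DAG; instance 0∕1.  CLASSIFICATION OF NE9 UNCHANGED: WORK-bound (W1 = the one-step renormalization
transformation as a Lean object).

HONEST FRAMING: bookkeeping for rung (B)+1 on ONE FIXED finite four-torus; elementary real analysis on hypothesis SHAPES (NE7, NE7b, NE-R1,
H-U5b-1, tower-NE5 — the cell's located new estimates, none in print for Bałaban's d = 4 procedure); (2.43)∕(2.44) are Bałaban's printed Theorem 2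
of [III], displayed as the SHAPE of a size branch and NOT proved here; NE9 NOT PRINTED ∕ NOT PROVED; spine PROVED 0∕9 unchanged; NOT UV stability,
NOT the continuum limit, NOT infinite volume, NOT a mass gap, NOT Clay.  HONEST DEPENDENCY: continuum YM on T⁴ ⇐ BetaPertH ∧ nine spine estimates
(0∕9 proved); BetaPertH ⇐ (D1) ∧ (D4) ∧ CAP+tail.

References (TYPES only): [King1986] = C. King, Commun. Math. Phys. **102** (1986) 649–677, Thm 3.4 (3.9) p. 656, p. 657; [Balaban1988Convergent] =
T. Bałaban, Commun. Math. Phys. **119** (1988) 243–285, Thm 2 (2.43)–(2.44) p. 263.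
-/

namespace Summit.QuantumFields.BalabanUV.T4Continuum.NE9.DirectPairingEnd

open scoped BigOperators
open Finset Filter Topology
open Literature.MathematicalPhysics.QuantumFieldTheory.Balaban1983to89
open T4CauchySum (genFun genFunLim)
open T4HybridMatching (HybridSandwich hybridDelta)
open T4GoodClassBudget (GoodClause)
open T4MatchingClosure (ReindexedBudget goodClause_of_reindexed)
open Summit.QuantumFields.BalabanUV.T4Continuum.NE9.DirectPairingApex
  (kingMatching_of_hybridSandwich cauchy_of_hybridSandwichFamily)
open Summit.QuantumFields.BalabanUV.T4Continuum.NE9.DirectPairingApexBudget (tendsto_reindexedDelta)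

/-! ## §1 The `summable` fields are idle for King's matching: the good clause + bad-class inequalities give the hybrid sandwich per pair -/

section Fields

variable {ι : Type*} [DecidableEq ι] {l₀ vol : ℝ} {W δ : ℕ → ℝ} {Z : ℕ → ℝ → ℝ}

/-- **THE HYBRID SANDWICH PER PAIR FROM FIELD-LEVEL DATA, NO SUMMABILITY.**  For every `n`: the good clause
`T4GoodClassBudget.GoodClause l₀ vol (T n) (A n) (B n) (Bad n) δ` (core sandwich with a `t`-free constant and width `vol·δ K`), the bad
class inside the term family, nonnegative term weights, and the two bad-class RELATIVE-WEIGHT inequalities with weight `W K` — the fields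
`bad_subset`, `bad_left`, `bad_right` of NE7b's output shape `T4WeightBudget.RelWeightBound` WITHOUT its `summable` (and `lt_one`, `nonneg`)
fields — give, per pair `(K, n)` and `|t| ≤ l₀`, the tree's `HybridSandwich` on the good set `T n K ∖ Bad n K t`: the `h` binder of
`DirectPairingApex.kingMatching_of_hybridSandwich` (index order `(K, n)`). [folklore] -/
theorem hybridSandwich_of_goodClause (T : ℕ → ℕ → Finset ι) (A B : ℕ → ℕ → ℝ → ι → ℝ) (Bad : ℕ → ℕ → ℝ → Finset ι)
    (hBad : ∀ n K t, |t| ≤ l₀ → Bad n K t ⊆ T n K)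
    (hA : ∀ n K t, |t| ≤ l₀ → ∀ τ ∈ T n K, 0 ≤ A n K t τ) (hB : ∀ n K t, |t| ≤ l₀ → ∀ τ ∈ T n K, 0 ≤ B n K t τ)
    (hbadA : ∀ n K t, |t| ≤ l₀ → ∑ τ ∈ Bad n K t, A n K t τ ≤ W K * ∑ τ ∈ T n K, A n K t τ)
    (hbadB : ∀ n K t, |t| ≤ l₀ → ∑ τ ∈ Bad n K t, B n K t τ ≤ W K * ∑ τ ∈ T n K, B n K t τ)
    (hgood : ∀ n, GoodClause l₀ vol (T n) (A n) (B n) (Bad n) δ) :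
    ∀ K n : ℕ, ∃ c : ℝ, ∀ t : ℝ, |t| ≤ l₀ →
      ∃ Gd : Finset ι, HybridSandwich (T n K) Gd (A n K t) (B n K t) c (vol * δ K) (W K) := by
  intro K n
  obtain ⟨c, hc⟩ := hgood n K
  refine ⟨c, fun t ht => ⟨T n K \ Bad n K t, ?_⟩⟩
  have hsd : T n K \ (T n K \ Bad n K t) = Bad n K t := by
    rw [sdiff_sdiff_right_self, inf_eq_inter, inter_eq_right.mpr (hBad n K t ht)]
  exact
    { subset := sdiff_subset
      nonneg_left := hA n K t ht
      nonneg_right := hB n K t ht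
      lower := fun τ hτ => (hc t ht τ hτ).1
      upper := fun τ hτ => (hc t ht τ hτ).2
      bad_left := by rw [hsd]; exact hbadA n K t ht
      bad_right := by rw [hsd]; exact hbadB n K t ht }

/-- **KING'S MATCHING FROM THE GOOD CLAUSE AND THE BAD-CLASS INEQUALITIES — `W K < 1` per cutoff, NO `Summable W`.**  Dictionary
`Z K = Σ A n K`, `Z (K + n) = Σ B n K` on `|t| ≤ l₀` with positive totals, the data of `hybridSandwich_of_goodClause`, `0 < vol` ⇒
`|log Z_{K+n}(t) − log Z_K(t) − c_{K,n}| ≤ vol·hybridDelta vol δ W K` for all `K`, `n` (`DirectPairingApex.kingMatching_of_hybridSandwich` BY NAME).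
Compare `DirectPairingApexDesign.kingMatching_of_design` (C38c), whose `RelWeightBound` ∕ `ShellWeightBound` binders carry `Summable W`, `Summable Wsh`.
[cite: King1986, Thm 3.4 (3.9) p. 656] [folklore] -/
theorem kingMatching_of_goodClause (hvol : 0 < vol) (T : ℕ → ℕ → Finset ι) (A B : ℕ → ℕ → ℝ → ι → ℝ)
    (Bad : ℕ → ℕ → ℝ → Finset ι) (hBad : ∀ n K t, |t| ≤ l₀ → Bad n K t ⊆ T n K)
    (hA : ∀ n K t, |t| ≤ l₀ → ∀ τ ∈ T n K, 0 ≤ A n K t τ) (hB : ∀ n K t, |t| ≤ l₀ → ∀ τ ∈ T n K, 0 ≤ B n K t τ)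
    (hbadA : ∀ n K t, |t| ≤ l₀ → ∑ τ ∈ Bad n K t, A n K t τ ≤ W K * ∑ τ ∈ T n K, A n K t τ)
    (hbadB : ∀ n K t, |t| ≤ l₀ → ∑ τ ∈ Bad n K t, B n K t τ ≤ W K * ∑ τ ∈ T n K, B n K t τ)
    (hW1 : ∀ K, W K < 1)
    (hZA : ∀ n K t, |t| ≤ l₀ → Z K t = ∑ τ ∈ T n K, A n K t τ)
    (hZB : ∀ n K t, |t| ≤ l₀ → Z (K + n) t = ∑ τ ∈ T n K, B n K t τ)
    (hpos : ∀ n K t, |t| ≤ l₀ → 0 < ∑ τ ∈ T n K, A n K t τ)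
    (hgood : ∀ n, GoodClause l₀ vol (T n) (A n) (B n) (Bad n) δ) :
    ∀ K n : ℕ, ∃ c : ℝ, ∀ t : ℝ, |t| ≤ l₀ →
      |Real.log (Z (K + n) t) - Real.log (Z K t) - c| ≤ vol * hybridDelta vol δ W K :=
  kingMatching_of_hybridSandwich hvol (fun K n => T n K) (fun K n => A n K) (fun K n => B n K)
    (fun K n t ht => hZA n K t ht) (fun K n t ht => hZB n K t ht) hW1 (fun K n t ht => hpos n K t ht)
    (hybridSandwich_of_goodClause T A B Bad hBad hA hB hbadA hbadB hgood)

/-- **NODE U6 FROM THE GOOD CLAUSE IN KING'S ORGANISATION — `δ → 0` AND `W → 0`, NOTHING SUMMED.**  Under the data of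
`kingMatching_of_goodClause` and `0 ≤ l₀`: every generating function `K ↦ genFun Z K t`, `|t| ≤ l₀`, is Cauchy with uniform convergence on the
closed `l₀`-ball (`DirectPairingApex.cauchy_of_hybridSandwichFamily` BY NAME). [cite: King1986, p. 657] [folklore] -/
theorem cauchy_of_goodClause (hvol : 0 < vol) (hl₀ : 0 ≤ l₀) (T : ℕ → ℕ → Finset ι) (A B : ℕ → ℕ → ℝ → ι → ℝ)
    (Bad : ℕ → ℕ → ℝ → Finset ι) (hBad : ∀ n K t, |t| ≤ l₀ → Bad n K t ⊆ T n K)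
    (hA : ∀ n K t, |t| ≤ l₀ → ∀ τ ∈ T n K, 0 ≤ A n K t τ) (hB : ∀ n K t, |t| ≤ l₀ → ∀ τ ∈ T n K, 0 ≤ B n K t τ)
    (hbadA : ∀ n K t, |t| ≤ l₀ → ∑ τ ∈ Bad n K t, A n K t τ ≤ W K * ∑ τ ∈ T n K, A n K t τ)
    (hbadB : ∀ n K t, |t| ≤ l₀ → ∑ τ ∈ Bad n K t, B n K t τ ≤ W K * ∑ τ ∈ T n K, B n K t τ)
    (hW1 : ∀ K, W K < 1) (hW : Tendsto W atTop (𝓝 0)) (hδ : Tendsto δ atTop (𝓝 0))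
    (hZA : ∀ n K t, |t| ≤ l₀ → Z K t = ∑ τ ∈ T n K, A n K t τ)
    (hZB : ∀ n K t, |t| ≤ l₀ → Z (K + n) t = ∑ τ ∈ T n K, B n K t τ)
    (hpos : ∀ n K t, |t| ≤ l₀ → 0 < ∑ τ ∈ T n K, A n K t τ)
    (hgood : ∀ n, GoodClause l₀ vol (T n) (A n) (B n) (Bad n) δ) :
    (∀ t : ℝ, |t| ≤ l₀ → CauchySeq fun K => genFun Z K t) ∧
      TendstoUniformlyOn (fun K t => genFun Z K t) (genFunLim Z) atTop {t | |t| ≤ l₀} :=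
  cauchy_of_hybridSandwichFamily hvol hl₀ (fun K n => T n K) (fun K n => A n K) (fun K n => B n K)
    (fun K n t ht => hZA n K t ht) (fun K n t ht => hZB n K t ht) hW1 hδ hW (fun K n t ht => hpos n K t ht)
    (hybridSandwich_of_goodClause T A B Bad hBad hA hB hbadA hbadB hgood)

/-- **NODE U6 FROM THE RE-INDEXED TERM BUDGET WITH A BAD-CLASS WEIGHT THAT ONLY TENDS TO ZERO** (the summability-free form of
`DirectPairingApexBudget.cauchy_of_reindexedBudget`, C38d; shell-free).  Per pair: the cell's `T4MatchingClosure.ReindexedBudget` for the terms with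
rate profiles `r, u, s, s₂` independent of `n` (that structure has NO summability field), the bad-class inequalities with weight `W K < 1`, nonnegative
weights, the dictionary; and `r, u, s, s₂ → 0`, `W → 0` ⇒ Cauchy generating functions with uniform convergence on the `l₀`-ball.  THIS is the END an
ADAPTED recent window (C40: bad-class budget `V·r₀^{m(K)} → 0`, in general NOT summable — §2) can feed; `cauchy_of_reindexedBudget` cannot take it.
[cite: King1986, p. 657] [folklore] -/
theorem cauchy_of_reindexedBudget₀ (hvol : 0 < vol) (hl₀ : 0 ≤ l₀) (T : ℕ → ℕ → Finset ι) (A B : ℕ → ℕ → ℝ → ι → ℝ)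
    (Bad : ℕ → ℕ → ℝ → Finset ι) (Cc Rr CcRec RrRec : ℕ → ℕ → ℝ → ι → ℝ) (ν c₀ : ℕ → ℕ → ℝ) {r u s s₂ : ℕ → ℝ}
    (hBad : ∀ n K t, |t| ≤ l₀ → Bad n K t ⊆ T n K)
    (hA : ∀ n K t, |t| ≤ l₀ → ∀ τ ∈ T n K, 0 ≤ A n K t τ) (hB : ∀ n K t, |t| ≤ l₀ → ∀ τ ∈ T n K, 0 ≤ B n K t τ)
    (hbadA : ∀ n K t, |t| ≤ l₀ → ∑ τ ∈ Bad n K t, A n K t τ ≤ W K * ∑ τ ∈ T n K, A n K t τ)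
    (hbadB : ∀ n K t, |t| ≤ l₀ → ∑ τ ∈ Bad n K t, B n K t τ ≤ W K * ∑ τ ∈ T n K, B n K t τ)
    (hW1 : ∀ K, W K < 1) (hW : Tendsto W atTop (𝓝 0))
    (hZA : ∀ n K t, |t| ≤ l₀ → Z K t = ∑ τ ∈ T n K, A n K t τ)
    (hZB : ∀ n K t, |t| ≤ l₀ → Z (K + n) t = ∑ τ ∈ T n K, B n K t τ)
    (hpos : ∀ n K t, |t| ≤ l₀ → 0 < ∑ τ ∈ T n K, A n K t τ)
    (hRB : ∀ n, ReindexedBudget l₀ vol (T n) (A n) (B n) (Bad n) (Cc n) (Rr n) (CcRec n) (RrRec n) (ν n) u s₂ (c₀ n) r s)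
    (hr : Tendsto r atTop (𝓝 0)) (hu : Tendsto u atTop (𝓝 0)) (hs : Tendsto s atTop (𝓝 0))
    (hs₂ : Tendsto s₂ atTop (𝓝 0)) :
    (∀ t : ℝ, |t| ≤ l₀ → CauchySeq fun K => genFun Z K t) ∧
      TendstoUniformlyOn (fun K t => genFun Z K t) (genFunLim Z) atTop {t | |t| ≤ l₀} :=
  cauchy_of_goodClause hvol hl₀ T A B Bad hBad hA hB hbadA hbadB hW1 hW (tendsto_reindexedDelta hr hu hs hs₂) hZA hZB hpos
    fun n => goodClause_of_reindexed (hRB n)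

end Fields

/-! ## §2 Two-sided: under a SUMMABLE bad-class budget no window passes a slowly decaying profile — the `summable` fields exclude King's window -/

/-- The profile `b_j = 1∕log(j+2)` is admissible in King's currency: nonnegative and tending to zero. [folklore] -/
theorem logProfile_admissible :
    (∀ j : ℕ, 0 ≤ 1 / Real.log ((j : ℝ) + 2)) ∧ Tendsto (fun j : ℕ => 1 / Real.log ((j : ℝ) + 2)) atTop (𝓝 0) := by
  refine ⟨fun j => div_nonneg zero_le_one (Real.log_nonneg (by linarith [(Nat.cast_nonneg j : (0 : ℝ) ≤ j)])), ?_⟩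
  have h1 : Tendsto (fun j : ℕ => (j : ℝ) + 2) atTop atTop :=
    tendsto_atTop_add_const_right _ _ tendsto_natCast_atTop_atTop
  have h2 : Tendsto (fun j : ℕ => Real.log ((j : ℝ) + 2)) atTop atTop := Real.tendsto_log_atTop.comp h1
  have h3 := tendsto_inv_atTop_zero.comp h2
  refine h3.congr fun j => ?_
  simp only [Function.comp_apply, one_div]

/-- **A SUMMABLE BAD-CLASS BUDGET KILLS KING'S QUALITATIVE CURRENCY AT NODE U5b.**  Let `0 < r₀ < 1` (NE7b's bad-class rate), `Λ ≥ r₀⁻¹`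
(multiplicity base — `Λ = L⁴` is large), and let the window `m K ≤ K` have a SUMMABLE budget `Σ_K r₀^{m K} < ∞` (what the field `RelWeightBound.summable`
demands of `W K = V·r₀^{K − j⋆(K)}`, `T4MatchingClosure.relWeightBound_of_slotDom_log`).  Then the admissible profile `b_j = 1∕log(j+2)` defeats the window:
`Σ_{j=K−m(K)}^{K} b_j·Λ^{K−j}` does NOT tend to zero.  Reason: summability against the harmonic series gives `r₀^{m K} < 1∕(K+1)` for infinitely many `K`,
there `Λ^{m K} ≥ r₀^{−m K} > K + 1`, and the `j = K − m K` term is `≥ (K+1)∕log(K+2) ≥ 1`.  So with the `summable` fields in force the E-side owes node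
U5b's deviation slot a RATE (e.g. `b_j·(K+1)^{C log Λ} → 0` on the log window), not a profile; King's adapted window (C40) needs §1. [folklore] -/
theorem summableBudget_window_not_tendsto {r₀ Λ : ℝ} (h0 : 0 < r₀) (h1 : r₀ < 1) (hΛ : r₀⁻¹ ≤ Λ) {m : ℕ → ℕ}
    (hmK : ∀ K, m K ≤ K) (hsum : Summable (fun K => r₀ ^ m K)) :
    ¬ Tendsto (fun K : ℕ => ∑ j ∈ Icc (K - m K) K, 1 / Real.log ((j : ℝ) + 2) * Λ ^ (K - j)) atTop (𝓝 0) := by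
  intro h
  have hΛ1 : 1 ≤ Λ := (one_le_inv₀ h0 |>.mpr h1.le).trans hΛ
  -- frequently `r₀^{m K} < 1/(K+1)` (else the budget dominates the harmonic series)
  have hfreq : ∃ᶠ K in atTop, r₀ ^ m K < 1 / ((K : ℝ) + 1) := by
    by_contra hnot
    rw [not_frequently] at hnot
    simp only [not_lt] at hnot
    obtain ⟨K₀, hK₀⟩ := hnot.exists_forall_of_atTop
    have hs : Summable (fun K : ℕ => 1 / (((K + K₀ : ℕ) : ℝ) + 1)) := by
      refine ((summable_nat_add_iff K₀).mpr hsum).of_nonneg_of_le (fun K => by positivity) fun K => ?_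
      exact hK₀ (K + K₀) (Nat.le_add_left K₀ K)
    refine Real.not_summable_one_div_natCast ((summable_nat_add_iff (K₀ + 1)).mp ?_)
    refine hs.congr fun K => ?_
    push_cast; ring
  -- at such `K` the window sum is `≥ 1`
  have hge : ∃ᶠ K in atTop, (1 : ℝ) ≤ ∑ j ∈ Icc (K - m K) K, 1 / Real.log ((j : ℝ) + 2) * Λ ^ (K - j) := by
    refine hfreq.mono fun K hK => ?_
    have hmem : K - m K ∈ Icc (K - m K) K := by rw [mem_Icc]; omega
    have hlogpos : ∀ j : ℕ, 0 < Real.log ((j : ℝ) + 2) := fun j =>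
      Real.log_pos (by linarith [(Nat.cast_nonneg j : (0 : ℝ) ≤ j)])
    have hterm : (1 : ℝ) ≤ 1 / Real.log ((((K - m K : ℕ)) : ℝ) + 2) * Λ ^ (K - (K - m K)) := by
      rw [show K - (K - m K) = m K by have := hmK K; omega]
      -- `Λ^{m K} ≥ (r₀⁻¹)^{m K} > K + 1`
      have hpow : (K : ℝ) + 1 < Λ ^ m K := by
        have h2 : (r₀⁻¹) ^ m K ≤ Λ ^ m K := pow_le_pow_left₀ (inv_nonneg.mpr h0.le) hΛ _
        have h3 : (K : ℝ) + 1 < (r₀⁻¹) ^ m K := by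
          rw [inv_pow, lt_inv_comm₀ (by positivity) (pow_pos h0 _), ← one_div]
          exact hK
        exact h3.trans_le h2
      -- `log(j+2) ≤ j + 1 ≤ K + 1` for `j = K − m K`
      have hlog : Real.log ((((K - m K : ℕ)) : ℝ) + 2) ≤ (K : ℝ) + 1 := by
        have hj : (((K - m K : ℕ)) : ℝ) ≤ K := by exact_mod_cast Nat.sub_le K (m K)
        have := Real.log_le_sub_one_of_pos (show (0 : ℝ) < ((K - m K : ℕ) : ℝ) + 2 by positivity)
        linarith
      rw [div_mul_eq_mul_div, one_mul, le_div_iff₀ (hlogpos _), one_mul]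
      exact hlog.trans hpow.le
    exact hterm.trans (single_le_sum (f := fun j : ℕ => 1 / Real.log ((j : ℝ) + 2) * Λ ^ (K - j))
      (fun j _ => mul_nonneg (le_of_lt (div_pos one_pos (hlogpos j))) (pow_nonneg (by linarith) _)) hmem)
  -- contradiction with `→ 0`
  have hev : ∀ᶠ K in atTop, ∑ j ∈ Icc (K - m K) K, 1 / Real.log ((j : ℝ) + 2) * Λ ^ (K - j) < 1 :=
    h.eventually (gt_mem_nhds zero_lt_one)
  obtain ⟨K, hK1, hK2⟩ := (hge.and_eventually hev).exists
  exact absurd hK1 (not_le.mpr hK2)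

/-! ## §3 The E-side END along a given King window: C39's crossover majorant in the radius slot, the window sum in the deviation slot -/

section End

variable {ι : Type*} [DecidableEq ι] {l₀ vol : ℝ} {Z : ℕ → ℝ → ℝ}
  {E₁ a Λ b₀ β' R₁ r₀ V Cw : ℝ} {κ₀ : ℕ} {g : ℕ → ℝ} {gs : ℕ → ℕ → ℝ} {b w u s' s₂ : ℕ → ℝ} {m : ℕ → ℕ}

/-- **THE E-SIDE OF NE9-AS-CONSUMED ON THE KING ROUTE, ALONG A KING WINDOW.**  INPUT from the E-side: ONE nonnegative scale profile `b_j → 0`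
(§17 rows 1–5 of `NE9.md`: `TowerCarriersKing.exists_profile_carriers`; no modulus, no constant, no rate).  PRINTED data: the one-run size branch
`E₁aⁿ` ∕ `R₁ g_j^{κ₀}` ([Balaban1988Convergent] Thm 2 (2.43)∕(2.44), a T-row displayed as a SHAPE) under the lower half of (0.31), `κ₀ > 2`.  DESIGN data:
a King window `m` — bad-class budget `V·r₀^{m K} → 0` with `V·r₀^{m K} < 1` and deviation window sum `Σ_{j=K−m K}^{K} b_jΛ^{K−j} → 0` (BOTH exist for every
profile and cap by `DirectPairingWindow.exists_kingWindow`, C40; the budget is in general NOT summable, §2) — and the NON-E-side rate pieces `w` (last step ∕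
weights), `u` (UV radius: the unpaired scales' printed tails `E₁a^{K+1}∕(1−a) + Σ_{i≥K+1} R₁(b₀ i)^{−κ₀∕2} → 0` of `DirectPairingUVTail`, C41, plus NE-R1 (γ)
proper), `s'` (the other kinds' deviations), `s₂` (NE-R1 (β)) `→ 0` — the T4-DAG owner's.  PRODUCERS (owner T4-DAG; the hypotheses): the dictionary per
pair `(K, K + n)`, a bad class of relative weight `≤ V·r₀^{m K}` (NE7b's budget for the cut `j⋆(K) = K − m K`), and the cell's `T4MatchingClosure.ReindexedBudget`
whose recent slots carry the E-side majorants LITERALLY: radius `r K = Σ_{j+n=K} min(E₁aⁿ, b_jΛⁿ) + Σ_{j+n=K} min(R₁ g_j^{κ₀}, b_jΛⁿ) + w K` (node U4′,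
C39) and deviation `s K = Cw·Σ_{j=K−m K}^{K} b_jΛ^{K−j} + s' K` (node U5b's rate-only slot, C40).  CONCLUSION: every generating function `K ↦ genFun Z K t`,
`|t| ≤ l₀`, is Cauchy with uniform convergence on the `l₀`-ball — `DirectPairingCrossover.tendsto_kingCrossover` and §1's summability-free
`cauchy_of_reindexedBudget₀` BY NAME.  CONDITIONAL kernel theorem on hypothesis SHAPES; the slot assignment is the cell's (record `t4/T4-EST-U5E-b.md`),
not Bałaban's; nothing of [I]–[III] is asserted. [cite: King1986, Thm 3.4 (3.9) p. 656, p. 657] [folklore] -/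
theorem king_end_of_window (hvol : 0 < vol) (hl₀ : 0 ≤ l₀)
    (hb0 : ∀ j, 0 ≤ b j) (hb : Tendsto b atTop (𝓝 0)) (hE₁ : 0 ≤ E₁) (ha0 : 0 ≤ a) (ha1 : a < 1) (hΛ : 0 ≤ Λ)
    (hb₀ : 0 < b₀) (h031 : ∀ K, Step.Discrete031 b₀ β' K (g K) (gs K)) (hgs : ∀ K k, k ≤ K → 0 ≤ gs K k)
    (hR₁ : 0 ≤ R₁) (hκ : 2 < κ₀)
    (hW1 : ∀ K, V * r₀ ^ m K < 1) (hWm : Tendsto (fun K => V * r₀ ^ m K) atTop (𝓝 0))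
    (hwin : Tendsto (fun K => ∑ j ∈ Icc (K - m K) K, b j * Λ ^ (K - j)) atTop (𝓝 0))
    (hw : Tendsto w atTop (𝓝 0)) (hu : Tendsto u atTop (𝓝 0)) (hs' : Tendsto s' atTop (𝓝 0))
    (hs₂ : Tendsto s₂ atTop (𝓝 0))
    (T : ℕ → ℕ → Finset ι) (A B : ℕ → ℕ → ℝ → ι → ℝ) (Bad : ℕ → ℕ → ℝ → Finset ι)
    (Cc Rr CcRec RrRec : ℕ → ℕ → ℝ → ι → ℝ) (ν c₀ : ℕ → ℕ → ℝ)
    (hZA : ∀ n K t, |t| ≤ l₀ → Z K t = ∑ τ ∈ T n K, A n K t τ)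
    (hZB : ∀ n K t, |t| ≤ l₀ → Z (K + n) t = ∑ τ ∈ T n K, B n K t τ)
    (hpos : ∀ n K t, |t| ≤ l₀ → 0 < ∑ τ ∈ T n K, A n K t τ)
    (hBad : ∀ n K t, |t| ≤ l₀ → Bad n K t ⊆ T n K)
    (hA : ∀ n K t, |t| ≤ l₀ → ∀ τ ∈ T n K, 0 ≤ A n K t τ) (hB : ∀ n K t, |t| ≤ l₀ → ∀ τ ∈ T n K, 0 ≤ B n K t τ)
    (hbadA : ∀ n K t, |t| ≤ l₀ → ∑ τ ∈ Bad n K t, A n K t τ ≤ V * r₀ ^ m K * ∑ τ ∈ T n K, A n K t τ)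
    (hbadB : ∀ n K t, |t| ≤ l₀ → ∑ τ ∈ Bad n K t, B n K t τ ≤ V * r₀ ^ m K * ∑ τ ∈ T n K, B n K t τ)
    (hRB : ∀ n, ReindexedBudget l₀ vol (T n) (A n) (B n) (Bad n) (Cc n) (Rr n) (CcRec n) (RrRec n) (ν n) u s₂ (c₀ n)
      (fun K => (∑ p ∈ antidiagonal K, min (E₁ * a ^ p.2) (b p.1 * Λ ^ p.2))
        + (∑ p ∈ antidiagonal K, min (R₁ * gs K p.1 ^ κ₀) (b p.1 * Λ ^ p.2)) + w K)
      (fun K => Cw * ∑ j ∈ Icc (K - m K) K, b j * Λ ^ (K - j) + s' K)) :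
    (∀ t : ℝ, |t| ≤ l₀ → CauchySeq fun K => genFun Z K t) ∧
      TendstoUniformlyOn (fun K t => genFun Z K t) (genFunLim Z) atTop {t | |t| ≤ l₀} := by
  refine cauchy_of_reindexedBudget₀ (W := fun K => V * r₀ ^ m K) hvol hl₀ T A B Bad Cc Rr CcRec RrRec ν c₀ hBad hA hB
    hbadA hbadB hW1 hWm hZA hZB hpos hRB ?_ hu ?_ hs₂
  · -- recent radius: the King crossover majorant tends to zero (C39)
    exact DirectPairingCrossover.tendsto_kingCrossover hE₁ ha0 ha1 hΛ hb₀ h031 hgs hR₁ hκ hb0 hb hw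
  · -- recent deviation: the window sum (C40) + the other kinds
    simpa using (hwin.const_mul Cw).add hs'

end End


/-! ## §2b (v1.1, append-only) The two-sided witness for EVERY multiplicity base `Λ > 1` (the proviso `Λ ≥ r₀⁻¹` of §2 removed) -/

/-- **A SUMMABLE BAD-CLASS BUDGET KILLS KING'S QUALITATIVE CURRENCY AT NODE U5b — GENERAL FORM.**  For ANY `0 < r₀ < 1` (NE7b's bad-class rate, however
small) and ANY multiplicity base `Λ > 1`: every window `m K ≤ K` with `Σ_K r₀^{m K} < ∞` is defeated by the admissible profile `b_j = 1∕log(j+2)`.  Summability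
against the harmonic series gives `r₀^{m K} < 1∕(K+1)` for infinitely many `K`; taking logarithms, `Λ^{m K} > (K+1)^α` with `α = log Λ ∕ log r₀⁻¹ > 0`; and
`log(K+2) ≤ (K+2)^α∕α ≤ 2^α(K+1)^α∕α` (`Real.log_le_rpow_div`), so the `j = K − m K` term of the window sum is `≥ α∕2^α > 0` there.  Supersedes §2's
`summableBudget_window_not_tendsto` (`Λ ≥ r₀⁻¹`). [folklore] -/
theorem summableBudget_window_not_tendsto' {r₀ Λ : ℝ} (h0 : 0 < r₀) (h1 : r₀ < 1) (hΛ : 1 < Λ) {m : ℕ → ℕ}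
    (hmK : ∀ K, m K ≤ K) (hsum : Summable (fun K => r₀ ^ m K)) :
    ¬ Tendsto (fun K : ℕ => ∑ j ∈ Icc (K - m K) K, 1 / Real.log ((j : ℝ) + 2) * Λ ^ (K - j)) atTop (𝓝 0) := by
  intro h
  have hlogr : 0 < Real.log r₀⁻¹ := Real.log_pos (one_lt_inv₀ h0 |>.mpr h1)
  have hlogΛ : 0 < Real.log Λ := Real.log_pos hΛ
  set α : ℝ := Real.log Λ / Real.log r₀⁻¹ with hα
  have hαpos : 0 < α := div_pos hlogΛ hlogr
  have hlogpos : ∀ j : ℕ, 0 < Real.log ((j : ℝ) + 2) := fun j =>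
    Real.log_pos (by linarith [(Nat.cast_nonneg j : (0 : ℝ) ≤ j)])
  -- frequently `r₀^{m K} < 1/(K+1)` (else the budget dominates the harmonic series)
  have hfreq : ∃ᶠ K in atTop, r₀ ^ m K < 1 / ((K : ℝ) + 1) := by
    by_contra hnot
    rw [not_frequently] at hnot
    simp only [not_lt] at hnot
    obtain ⟨K₀, hK₀⟩ := hnot.exists_forall_of_atTop
    have hs : Summable (fun K : ℕ => 1 / (((K + K₀ : ℕ) : ℝ) + 1)) := by
      refine ((summable_nat_add_iff K₀).mpr hsum).of_nonneg_of_le (fun K => by positivity) fun K => ?_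
      exact hK₀ (K + K₀) (Nat.le_add_left K₀ K)
    refine Real.not_summable_one_div_natCast ((summable_nat_add_iff (K₀ + 1)).mp ?_)
    refine hs.congr fun K => ?_
    push_cast; ring
  -- eventually `log(K+2) ≤ (K+1)^α · 2^α`-type bound: use `log x ≤ x^α / α`
  -- at such `K`: `Λ^{m K} > (K+1)^α` and the `j = K − m K` term is `≥ (K+1)^α / log(K+2) ≥ α/2^α`... we show `≥ α / 2`
  have hge : ∃ᶠ K in atTop, α / (2 : ℝ) ^ α ≤ ∑ j ∈ Icc (K - m K) K, 1 / Real.log ((j : ℝ) + 2) * Λ ^ (K - j) := by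
    refine (hfreq.and_eventually (eventually_ge_atTop 1)).mono fun K ⟨hK, hK1⟩ => ?_
    have hmem : K - m K ∈ Icc (K - m K) K := by rw [mem_Icc]; omega
    have hterm : α / (2 : ℝ) ^ α ≤ 1 / Real.log ((((K - m K : ℕ)) : ℝ) + 2) * Λ ^ (K - (K - m K)) := by
      rw [show K - (K - m K) = m K by have := hmK K; omega]
      -- (1) `(K+1)^α < Λ^{m K}`: from `r₀^{m K} < 1/(K+1)` take logs
      have hK1r : (0 : ℝ) < (K : ℝ) + 1 := by positivity
      have hlog1 : Real.log ((K : ℝ) + 1) < (m K : ℝ) * Real.log r₀⁻¹ := by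
        have h2 : ((K : ℝ) + 1) < (r₀⁻¹) ^ m K := by
          rw [inv_pow, lt_inv_comm₀ hK1r (pow_pos h0 _), ← one_div]; exact hK
        have h3 := Real.log_lt_log hK1r h2
        rwa [Real.log_pow] at h3
      have hpow : ((K : ℝ) + 1) ^ α < Λ ^ m K := by
        rw [← Real.rpow_natCast Λ (m K), Real.rpow_def_of_pos hK1r, Real.rpow_def_of_pos (by linarith)]
        refine Real.exp_lt_exp.mpr ?_
        rw [hα]
        have : Real.log ((K : ℝ) + 1) * (Real.log Λ / Real.log r₀⁻¹)
            = (Real.log ((K : ℝ) + 1) / Real.log r₀⁻¹) * Real.log Λ := by ring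
        rw [this, mul_comm (Real.log Λ) ((m K : ℕ) : ℝ)]
        refine mul_lt_mul_of_pos_right ?_ hlogΛ
        rwa [div_lt_iff₀ hlogr]
      -- (2) `log(j+2) ≤ log(K+2) ≤ 2 (K+1)^α / α`-ish: use `Real.log_le_rpow_div` : log x ≤ x^ε / ε
      have hj : (((K - m K : ℕ)) : ℝ) + 2 ≤ (K : ℝ) + 2 := by
        have : ((K - m K : ℕ) : ℝ) ≤ K := by exact_mod_cast Nat.sub_le K (m K)
        linarith
      have hlogj : Real.log ((((K - m K : ℕ)) : ℝ) + 2) ≤ Real.log ((K : ℝ) + 2) :=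
        Real.log_le_log (by positivity) hj
      have hlogK : Real.log ((K : ℝ) + 2) ≤ ((K : ℝ) + 2) ^ α / α :=
        Real.log_le_rpow_div (by positivity) hαpos
      -- (K+2)^α ≤ 2^α (K+1)^α since K+2 ≤ 2(K+1)
      have h22 : ((K : ℝ) + 2) ^ α ≤ (2 : ℝ) ^ α * ((K : ℝ) + 1) ^ α := by
        rw [← Real.mul_rpow (by norm_num) hK1r.le]
        exact Real.rpow_le_rpow (by positivity) (by linarith) hαpos.le
      -- assemble: term ≥ (K+1)^α / (2^α (K+1)^α / α) = α / 2^α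
      have hD : Real.log ((((K - m K : ℕ)) : ℝ) + 2) ≤ (2 : ℝ) ^ α * ((K : ℝ) + 1) ^ α / α :=
        hlogj.trans (hlogK.trans (div_le_div_of_nonneg_right h22 hαpos.le))
      have hKα : 0 < ((K : ℝ) + 1) ^ α := Real.rpow_pos_of_pos hK1r α
      have h2pos : 0 < (2 : ℝ) ^ α := Real.rpow_pos_of_pos (by norm_num) α
      have hDpos : 0 < (2 : ℝ) ^ α * ((K : ℝ) + 1) ^ α / α := div_pos (mul_pos h2pos hKα) hαpos
      calc α / (2 : ℝ) ^ α = (1 / ((2 : ℝ) ^ α * ((K : ℝ) + 1) ^ α / α)) * ((K : ℝ) + 1) ^ α := by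
            field_simp
        _ ≤ 1 / Real.log ((((K - m K : ℕ)) : ℝ) + 2) * Λ ^ m K :=
            mul_le_mul (one_div_le_one_div_of_le (hlogpos _) hD) hpow.le hKα.le
              (le_of_lt (div_pos one_pos (hlogpos _)))
    exact hterm.trans (single_le_sum (f := fun j : ℕ => 1 / Real.log ((j : ℝ) + 2) * Λ ^ (K - j))
      (fun j _ => mul_nonneg (le_of_lt (div_pos one_pos (hlogpos j))) (pow_nonneg (by linarith) _)) hmem)
  have hev : ∀ᶠ K in atTop, ∑ j ∈ Icc (K - m K) K, 1 / Real.log ((j : ℝ) + 2) * Λ ^ (K - j) < α / (2 : ℝ) ^ α :=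
    h.eventually (gt_mem_nhds (div_pos hαpos (Real.rpow_pos_of_pos (by norm_num) α)))
  obtain ⟨K, hK1, hK2⟩ := (hge.and_eventually hev).exists
  exact absurd hK1 (not_le.mpr hK2)

end Summit.QuantumFields.BalabanUV.T4Continuum.NE9.DirectPairingEnd
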